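import Summits.AtomisticToContinuum.FouriersLaw.Theses.EmbeddedDrudeMourre
import Literature.MathematicalPhysics.KineticTheory.HarmonicChaosDecomposition
import Literature.MathematicalPhysics.KineticTheory.ZeroWavenumberSpace
import Literature.MathematicalPhysics.KineticTheory.InfiniteChainInvariantStates
import Literature.MathematicalPhysics.KineticTheory.InfiniteChainSuperstableDynamics
import HarnessLib

/-!
# Explicit Wick calculus of the harmonic chain on coordinate test functions, and thermal waves in the
unimodular variable `e^{ik}`
(helper for stub `stub_forceKernels` (KΦ) of line `gram-pencil-harmonic-chaos`, crux `EmbeddedDrudeMourre.DrudeDissolution`,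
item stmt-AtomisticToContinuum-12593; `--supports` file, closes nothing)

WHAT. The vocabulary of `HarmonicChaosDecomposition.lean` §4 (`linObs`, `thermalCov`, `wick`, `thermalWave`) made
explicit on the coordinate data `(δ_m a, 0) = a·q_m`, `(0, δ_m a) = a·p_m`, `r_m = q_{m+1} − q_m`: additivity and the values on
these (`linObs_tq`, `thermalCov_tq_tq`, …), Janson's recursion
unfolded at degree four (`wick_four`: `:φ₀φ₁φ₂φ₃: = φ₀φ₁φ₂φ₃ − Σ_{a<b} C_ab φ_cφ_d + (C₀₁C₂₃ + C₀₂C₁₃ + C₀₃C₁₂)`), and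
the thermal waves of the seven test functions `q₀, q₁, p₀, p₁, r₀, r₁, r₋₁` at `T = 1` in the unimodular variable
`(AddCircle.toCircle k : ℂ) = e^{ik}` (`w_Q0` … `cw_Rm`), together with the dictionary `conj e = e⁻¹`, `cos k = (e + e⁻¹)/2`,
`i sin k = (e − e⁻¹)/2`, `ω(k)² = ω₂ + 2 − e − e⁻¹` (`cosT_coe_complex`, `I_mul_sinT_coe_complex`,
`dispersion_sq_coe_complex`) that turns every zero-momentum kernel identity of the stub into a rational identity.

HOW. `Finsupp.sum_add_index'` / `Finsupp.sum_single_index`; `AddCircle.toCircle` is a character with values in the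
unit circle (`toCircle_add/neg/zsmul`, `Circle.coe_inv_eq_conj`); on real representatives `toCircle ↑x = exp(ix)` and
`cosT ↑x = cos x`, `sinT ↑x = sin x` (`QuotientAddGroup.induction_on`).
-/

noncomputable section

namespace Summit.AtomisticToContinuum.FouriersLaw.Theorems.DrudeDissolution.GramPencilHarmonicChaos

open MeasureTheory Filter Set Function Topology
open scoped InnerProductSpace ENNReal ComplexConjugate
open Literature.MathematicalPhysics.KineticTheory
open Literature.MathematicalPhysics.KineticTheory.HeatConduction
open Literature.MathematicalPhysics.KineticTheory.PhononBoltzmann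
open HarmonicChaos ProbabilityTheory
open PinnedChainKinetic (𝕋 𝕋3 μ𝕋 μ𝕋3 k₄ sinT)
open scoped Literature.MathematicalPhysics.KineticTheory.HeatConduction.PinnedChainKinetic

/-! ## §1 Linear observables: the test functions `q_m`, `p_m`, `r_m` and the explicit Wick calculus on them -/

/-- `φ` is additive in the coefficient datum. [folklore] -/
theorem linObs_add (f g : TestFn) (σ : ChainConfig) :
    linObs (f + g) σ = linObs f σ + linObs g σ := by
  unfold linObs
  rw [Prod.fst_add, Prod.snd_add, Finsupp.sum_add_index', Finsupp.sum_add_index']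
  · ring
  all_goals intros; simp [add_mul]

/-- `φ(a·q_m)(σ) = a q_m`. [folklore] -/
theorem linObs_tq (m : ℤ) (a : ℝ) (σ : ChainConfig) : linObs (Finsupp.single m a, 0) σ = a * (σ m).1 := by
  simp [linObs, Finsupp.sum_single_index]

/-- `φ(a·p_m)(σ) = a p_m`. [folklore] -/
theorem linObs_tp (m : ℤ) (a : ℝ) (σ : ChainConfig) : linObs (0, Finsupp.single m a) σ = a * (σ m).2 := by
  simp [linObs, Finsupp.sum_single_index]

/-- The thermal covariance is additive in the first argument. [folklore] -/
theorem thermalCov_add_left (ω₂ T : ℝ) (f g h : TestFn) :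
    thermalCov ω₂ T (f + g) h = thermalCov ω₂ T f h + thermalCov ω₂ T g h := by
  unfold thermalCov
  rw [Prod.fst_add, Prod.snd_add, Finsupp.sum_add_index', Finsupp.sum_add_index']
  · ring
  all_goals intros; simp [add_mul, Finsupp.sum_add]

/-- The thermal covariance is additive in the second argument. [folklore] -/
theorem thermalCov_add_right (ω₂ T : ℝ) (f g h : TestFn) :
    thermalCov ω₂ T h (f + g) = thermalCov ω₂ T h f + thermalCov ω₂ T h g := by
  unfold thermalCov
  simp only [Prod.fst_add, Prod.snd_add, Finsupp.coe_add, Pi.add_apply]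
  rw [show (h.1.sum fun x a => (f.1 + g.1).sum fun y b => a * b * greenFn ω₂ (x - y)) =
      (h.1.sum fun x a => f.1.sum fun y b => a * b * greenFn ω₂ (x - y)) +
        h.1.sum fun x a => g.1.sum fun y b => a * b * greenFn ω₂ (x - y) from ?_]
  · simp only [mul_add, Finsupp.sum_add]
    ring
  · rw [← Finsupp.sum_add]
    apply Finsupp.sum_congr
    intro x _
    rw [Finsupp.sum_add_index']
    · intro y; ring
    · intro y b₁ b₂; ring

/-- `C_T(a q_m, b q_n) = T a b G(m − n)`. [folklore] -/
theorem thermalCov_tq_tq (ω₂ T : ℝ) (m n : ℤ) (a b : ℝ) :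
    thermalCov ω₂ T (Finsupp.single m a, 0) (Finsupp.single n b, 0) = T * (a * b * greenFn ω₂ (m - n)) := by
  simp [thermalCov, Finsupp.sum_single_index]

/-- `C_T(a p_m, b p_n) = T a b δ_{mn}`. [folklore] -/
theorem thermalCov_tp_tp (ω₂ T : ℝ) (m n : ℤ) (a b : ℝ) :
    thermalCov ω₂ T (0, Finsupp.single m a) (0, Finsupp.single n b) = T * (a * (Finsupp.single n b m)) := by
  simp [thermalCov, Finsupp.sum_single_index]

/-- Positions and momenta are uncorrelated. [folklore] -/
theorem thermalCov_tq_tp (ω₂ T : ℝ) (m n : ℤ) (a b : ℝ) :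
    thermalCov ω₂ T (Finsupp.single m a, 0) (0, Finsupp.single n b) = 0 := by
  simp [thermalCov]

/-- Momenta and positions are uncorrelated. [folklore] -/
theorem thermalCov_tp_tq (ω₂ T : ℝ) (m n : ℤ) (a b : ℝ) :
    thermalCov ω₂ T (0, Finsupp.single m a) (Finsupp.single n b, 0) = 0 := by
  simp [thermalCov]

/-- Janson's recursion unfolded at degree `4`: `:φ₀φ₁φ₂φ₃: = φ₀φ₁φ₂φ₃ − Σ_{a<b} C_ab φ_cφ_d + (C₀₁C₂₃ + C₀₂C₁₃ + C₀₃C₁₂)`.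
[cite: Janson1997, Thm 3.15] -/
theorem wick_four : ∀ (ω₂ T : ℝ) (f : Fin 4 → TestFn) (σ : ChainConfig),
    wick ω₂ T 4 f σ =
      linObs (f 0) σ * linObs (f 1) σ * linObs (f 2) σ * linObs (f 3) σ
        - thermalCov ω₂ T (f 0) (f 1) * (linObs (f 2) σ * linObs (f 3) σ)
        - thermalCov ω₂ T (f 0) (f 2) * (linObs (f 1) σ * linObs (f 3) σ)
        - thermalCov ω₂ T (f 0) (f 3) * (linObs (f 1) σ * linObs (f 2) σ)
        - thermalCov ω₂ T (f 1) (f 2) * (linObs (f 0) σ * linObs (f 3) σ)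
        - thermalCov ω₂ T (f 1) (f 3) * (linObs (f 0) σ * linObs (f 2) σ)
        - thermalCov ω₂ T (f 2) (f 3) * (linObs (f 0) σ * linObs (f 1) σ)
        + (thermalCov ω₂ T (f 0) (f 1) * thermalCov ω₂ T (f 2) (f 3)
          + thermalCov ω₂ T (f 0) (f 2) * thermalCov ω₂ T (f 1) (f 3)
          + thermalCov ω₂ T (f 0) (f 3) * thermalCov ω₂ T (f 1) (f 2)) := by
  intro ω₂ T f σ
  simp [wick, Fin.tail, Fin.removeNth, Fin.sum_univ_succ, Fin.succAbove]
  ring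

/-! ## §2 Thermal waves in the unimodular variable `e^{ik}` -/

/-- `e^{ik} ≠ 0`. [folklore] -/
theorem expT_ne_zero (k : 𝕋) : (AddCircle.toCircle k : ℂ) ≠ 0 := Circle.coe_ne_zero _

/-- `toCircle (n • k) = (e^{ik})^n`. [folklore] -/
theorem coe_toCircle_zsmul (n : ℤ) (k : 𝕋) :
    (((n • k).toCircle : Circle) : ℂ) = (AddCircle.toCircle k : ℂ) ^ n := by
  rw [AddCircle.toCircle_zsmul, Circle.coe_zpow]

/-- `fourier n k = (e^{ik})^n`. [folklore] -/
theorem fourier_eq_expT_zpow (n : ℤ) (k : 𝕋) : (fourier n k : ℂ) = (AddCircle.toCircle k : ℂ) ^ n := by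
  rw [fourier_apply, coe_toCircle_zsmul]

/-- `conj e^{ik} = e^{−ik}`. [folklore] -/
theorem conj_expT (k : 𝕋) : conj ((AddCircle.toCircle k : ℂ)) = ((AddCircle.toCircle k : ℂ))⁻¹ := by
  rw [← Circle.coe_inv_eq_conj, Circle.coe_inv]

/-- `e^{i(−k)} = (e^{ik})⁻¹`. [folklore] -/
theorem expT_neg (k : 𝕋) : (AddCircle.toCircle (-k) : ℂ) = ((AddCircle.toCircle k : ℂ))⁻¹ := by
  rw [AddCircle.toCircle_neg, Circle.coe_inv]

/-- `e^{i(k+k')} = e^{ik} e^{ik'}`. [folklore] -/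
theorem expT_add (k k' : 𝕋) : (AddCircle.toCircle (k + k') : ℂ) = (AddCircle.toCircle k : ℂ) * (AddCircle.toCircle k' : ℂ) := by
  rw [AddCircle.toCircle_add, Circle.coe_mul]

/-- `e^{i(k−k')} = e^{ik} (e^{ik'})⁻¹`. [folklore] -/
theorem expT_sub (k k' : 𝕋) : (AddCircle.toCircle (k - k') : ℂ) = (AddCircle.toCircle k : ℂ) * ((AddCircle.toCircle k' : ℂ))⁻¹ := by
  rw [sub_eq_add_neg, expT_add, expT_neg]

/-- The shell momentum: `e^{i(k₁+k₂−k₃)} = e₁ e₂ e₃⁻¹`. [folklore] -/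
theorem expT_k4 (k₁ k₂ k₃ : 𝕋) : (AddCircle.toCircle (k₁ + k₂ - k₃) : ℂ) = (AddCircle.toCircle k₁ : ℂ) * (AddCircle.toCircle k₂ : ℂ) * ((AddCircle.toCircle k₃ : ℂ))⁻¹ := by
  rw [expT_sub, expT_add]

/-- `e^{ix}` on real representatives. [folklore] -/
theorem expT_coe_eq_exp (x : ℝ) : (AddCircle.toCircle (x : 𝕋) : ℂ) = Complex.exp (x * Complex.I) := by
  rw [AddCircle.toCircle_apply_mk, Circle.coe_exp]
  congr 2
  have hπ : (Real.pi : ℝ) ≠ 0 := Real.pi_ne_zero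
  push_cast
  field_simp

/-- `cos k = (e + e⁻¹)/2`. [folklore] -/
theorem cosT_coe_complex (k : 𝕋) :
    ((PinnedChainKinetic.cosT k : ℝ) : ℂ) = ((AddCircle.toCircle k : ℂ) + ((AddCircle.toCircle k : ℂ))⁻¹) / 2 := by
  induction k using QuotientAddGroup.induction_on with
  | H x =>
    rw [expT_coe_eq_exp, PinnedChainKinetic.cosT_coe, Complex.ofReal_cos, Complex.cos,
      ← Complex.exp_neg, neg_mul]

/-- `i sin k = (e − e⁻¹)/2`. [folklore] -/
theorem I_mul_sinT_coe_complex (k : 𝕋) :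
    Complex.I * ((sinT k : ℝ) : ℂ) = ((AddCircle.toCircle k : ℂ) - ((AddCircle.toCircle k : ℂ))⁻¹) / 2 := by
  induction k using QuotientAddGroup.induction_on with
  | H x =>
    rw [expT_coe_eq_exp, PinnedChainKinetic.sinT_coe, Complex.ofReal_sin, Complex.sin, ← Complex.exp_neg,
      neg_mul]
    have hI : Complex.I * Complex.I = -1 := Complex.I_mul_I
    linear_combination (Complex.exp (-(↑x * Complex.I)) - Complex.exp (↑x * Complex.I)) / 2 * hI

/-- The band relation `ω(k)² = ω₂ + 2 − e − e⁻¹`. [cite: AokiLukkarinenSpohn2006, §3 eq. (3.4)] -/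
theorem dispersion_sq_coe_complex {ω₂ : ℝ} (hω : 0 ≤ ω₂) (k : 𝕋) :
    ((PinnedChainKinetic.dispersion ω₂ k : ℝ) : ℂ) ^ 2 = (ω₂ : ℂ) + 2 - (AddCircle.toCircle k : ℂ) - ((AddCircle.toCircle k : ℂ))⁻¹ := by
  have h : PinnedChainKinetic.dispersion ω₂ k ^ 2 = ω₂ + 2 * (1 - PinnedChainKinetic.cosT k) := by
    unfold PinnedChainKinetic.dispersion
    refine Real.sq_sqrt ?_
    have := (abs_le.1 (PinnedChainKinetic.abs_cosT_le_one k)).2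
    nlinarith
  have h' : ((PinnedChainKinetic.dispersion ω₂ k : ℝ) : ℂ) ^ 2 =
      ((ω₂ + 2 * (1 - PinnedChainKinetic.cosT k) : ℝ) : ℂ) := by
    rw [← h]; push_cast; ring
  rw [h']
  push_cast
  rw [cosT_coe_complex]
  ring

/-- The thermal wave is additive in the coefficient datum. [folklore] -/
theorem thermalWave_add (ω₂ T : ℝ) (f g : TestFn) (k : 𝕋) :
    thermalWave ω₂ T (f + g) k = thermalWave ω₂ T f k + thermalWave ω₂ T g k := by
  unfold thermalWave
  rw [Prod.fst_add, Prod.snd_add, Finsupp.sum_add_index', Finsupp.sum_add_index']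
  · ring
  all_goals intros; simp [add_mul, add_div]

/-- `w_{a q_m}(k) = √(T/2) a e^{ikm}/ω(k)`. [folklore] -/
theorem thermalWave_tq (ω₂ T : ℝ) (m : ℤ) (a : ℝ) (k : 𝕋) :
    thermalWave ω₂ T (Finsupp.single m a, 0) k =
      (Real.sqrt (T / 2) : ℂ) * ((a : ℂ) * (AddCircle.toCircle k : ℂ) ^ m / (PinnedChainKinetic.dispersion ω₂ k : ℂ)) := by
  simp [thermalWave, Finsupp.sum_single_index, coe_toCircle_zsmul]

/-- `w_{a p_m}(k) = −i √(T/2) a e^{ikm}`. [folklore] -/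
theorem thermalWave_tp (ω₂ T : ℝ) (m : ℤ) (a : ℝ) (k : 𝕋) :
    thermalWave ω₂ T (0, Finsupp.single m a) k =
      (Real.sqrt (T / 2) : ℂ) * (-(Complex.I * ((a : ℂ) * (AddCircle.toCircle k : ℂ) ^ m))) := by
  simp [thermalWave, Finsupp.sum_single_index, coe_toCircle_zsmul]

section Waves
variable (ω₂ : ℝ) (k : 𝕋)

/-- `w_{q₀} = s/ω`. [folklore] -/
theorem w_Q0 : thermalWave ω₂ 1 ((Finsupp.single 0 1, 0)) k = ((Real.sqrt (1 / 2) : ℝ) : ℂ) * (1 / ((PinnedChainKinetic.dispersion ω₂ k : ℝ) : ℂ)) := by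
  rw [thermalWave_tq]; push_cast; simp only [zpow_zero]; ring
/-- `w_{q₁} = s e/ω`. [folklore] -/
theorem w_Q1 : thermalWave ω₂ 1 ((Finsupp.single 1 1, 0)) k = ((Real.sqrt (1 / 2) : ℝ) : ℂ) * ((AddCircle.toCircle k : ℂ) / ((PinnedChainKinetic.dispersion ω₂ k : ℝ) : ℂ)) := by
  rw [thermalWave_tq]; push_cast; simp only [zpow_one, one_mul]
/-- `w_{p₀} = −is`. [folklore] -/
theorem w_P0 : thermalWave ω₂ 1 ((0, Finsupp.single 0 1)) k = ((Real.sqrt (1 / 2) : ℝ) : ℂ) * (-Complex.I) := by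
  rw [thermalWave_tp]; push_cast; simp only [zpow_zero]; ring
/-- `w_{p₁} = −ise`. [folklore] -/
theorem w_P1 : thermalWave ω₂ 1 ((0, Finsupp.single 1 1)) k = ((Real.sqrt (1 / 2) : ℝ) : ℂ) * (-(Complex.I * (AddCircle.toCircle k : ℂ))) := by
  rw [thermalWave_tp]; push_cast; simp only [zpow_one]; ring
/-- `w_{r₀} = s(e − 1)/ω`. [folklore] -/
theorem w_R0 : thermalWave ω₂ 1 (((Finsupp.single 1 1, 0) + (Finsupp.single 0 (-1), 0))) k = ((Real.sqrt (1 / 2) : ℝ) : ℂ) * (((AddCircle.toCircle k : ℂ) - 1) / ((PinnedChainKinetic.dispersion ω₂ k : ℝ) : ℂ)) := by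
  rw [thermalWave_add, thermalWave_tq, thermalWave_tq]; push_cast; simp only [zpow_zero, zpow_one]; ring
/-- `w_{r₁} = s(e² − e)/ω`. [folklore] -/
theorem w_R1 : thermalWave ω₂ 1 (((Finsupp.single 2 1, 0) + (Finsupp.single 1 (-1), 0))) k = ((Real.sqrt (1 / 2) : ℝ) : ℂ) * (((AddCircle.toCircle k : ℂ) ^ 2 - (AddCircle.toCircle k : ℂ)) / ((PinnedChainKinetic.dispersion ω₂ k : ℝ) : ℂ)) := by
  rw [thermalWave_add, thermalWave_tq, thermalWave_tq]; push_cast; simp only [zpow_two, zpow_one]; ring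
/-- `w_{r₋₁} = s(1 − e⁻¹)/ω`. [folklore] -/
theorem w_Rm : thermalWave ω₂ 1 (((Finsupp.single 0 1, 0) + (Finsupp.single (-1) (-1), 0))) k = ((Real.sqrt (1 / 2) : ℝ) : ℂ) * ((1 - (AddCircle.toCircle k : ℂ)⁻¹) / ((PinnedChainKinetic.dispersion ω₂ k : ℝ) : ℂ)) := by
  rw [thermalWave_add, thermalWave_tq, thermalWave_tq]; push_cast; simp only [zpow_zero, zpow_neg_one]; ring

/-- `conj w_{q₀} = s/ω`. [folklore] -/
theorem cw_Q0 : conj (thermalWave ω₂ 1 ((Finsupp.single 0 1, 0)) k) = ((Real.sqrt (1 / 2) : ℝ) : ℂ) * (1 / ((PinnedChainKinetic.dispersion ω₂ k : ℝ) : ℂ)) := by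
  rw [w_Q0]; simp only [map_div₀, map_mul, map_one, Complex.conj_ofReal]
/-- `conj w_{q₁} = s e⁻¹/ω`. [folklore] -/
theorem cw_Q1 : conj (thermalWave ω₂ 1 ((Finsupp.single 1 1, 0)) k) = ((Real.sqrt (1 / 2) : ℝ) : ℂ) * ((AddCircle.toCircle k : ℂ)⁻¹ / ((PinnedChainKinetic.dispersion ω₂ k : ℝ) : ℂ)) := by
  rw [w_Q1]; simp only [map_div₀, map_mul, Complex.conj_ofReal, conj_expT]
/-- `conj w_{p₀} = is`. [folklore] -/
theorem cw_P0 : conj (thermalWave ω₂ 1 ((0, Finsupp.single 0 1)) k) = ((Real.sqrt (1 / 2) : ℝ) : ℂ) * Complex.I := by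
  rw [w_P0]; simp only [map_neg, map_mul, Complex.conj_ofReal, Complex.conj_I, neg_neg]
/-- `conj w_{p₁} = ise⁻¹`. [folklore] -/
theorem cw_P1 : conj (thermalWave ω₂ 1 ((0, Finsupp.single 1 1)) k) = ((Real.sqrt (1 / 2) : ℝ) : ℂ) * (Complex.I * (AddCircle.toCircle k : ℂ)⁻¹) := by
  rw [w_P1]; simp only [map_neg, map_mul, Complex.conj_ofReal, Complex.conj_I, conj_expT, neg_mul, neg_neg]
/-- `conj w_{r₀} = s(e⁻¹ − 1)/ω`. [folklore] -/
theorem cw_R0 : conj (thermalWave ω₂ 1 (((Finsupp.single 1 1, 0) + (Finsupp.single 0 (-1), 0))) k) = ((Real.sqrt (1 / 2) : ℝ) : ℂ) * (((AddCircle.toCircle k : ℂ)⁻¹ - 1) / ((PinnedChainKinetic.dispersion ω₂ k : ℝ) : ℂ)) := by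
  rw [w_R0]; simp only [map_div₀, map_mul, map_sub, map_one, Complex.conj_ofReal, conj_expT]
/-- `conj w_{r₁} = s(e⁻² − e⁻¹)/ω`. [folklore] -/
theorem cw_R1 : conj (thermalWave ω₂ 1 (((Finsupp.single 2 1, 0) + (Finsupp.single 1 (-1), 0))) k) = ((Real.sqrt (1 / 2) : ℝ) : ℂ) * (((AddCircle.toCircle k : ℂ)⁻¹ ^ 2 - (AddCircle.toCircle k : ℂ)⁻¹) / ((PinnedChainKinetic.dispersion ω₂ k : ℝ) : ℂ)) := by
  rw [w_R1]; simp only [map_div₀, map_mul, map_sub, map_pow, Complex.conj_ofReal, conj_expT]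
/-- `conj w_{r₋₁} = s(1 − e)/ω`. [folklore] -/
theorem cw_Rm : conj (thermalWave ω₂ 1 (((Finsupp.single 0 1, 0) + (Finsupp.single (-1) (-1), 0))) k) = ((Real.sqrt (1 / 2) : ℝ) : ℂ) * ((1 - (AddCircle.toCircle k : ℂ)) / ((PinnedChainKinetic.dispersion ω₂ k : ℝ) : ℂ)) := by
  rw [w_Rm]; simp only [map_div₀, map_mul, map_sub, map_one, map_inv₀, Complex.conj_ofReal, conj_expT, inv_inv]

end Waves

end Summit.AtomisticToContinuum.FouriersLaw.Theorems.DrudeDissolution.GramPencilHarmonicChaos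

end
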